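import Mathlib
import Summits.ValiantsHypothesis.ValiantsHypothesis.Theorems.NewtonUnitEquationsTwoProductsPlanarCellTwoRank
import Summits.ValiantsHypothesis.ValiantsHypothesis.Theorems.NewtonUnitEquationsTwoProductsPlanarCellTuranLite
import HarnessLib

/-!
# Crux `TwoProducts` (stmt-ValiantsHypothesis-5906), planar cells at `m = 2`: the √coin LAW is a theorem
# (`VisibleLeSqrtCoin`, the typed "random side" P2 of crux idea `coincidence-dichotomy`, discharged)

Theory lane (val-lit-p3 g13, CLAIM-FIRST #4; NOTE §13.4 (b) / §14.4 (1)).  val-idea-8 typed, as crit-3's price P2 of the crux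
idea `coincidence-dichotomy`, the conjectural `m = 2` law `VisibleLeSqrtCoin` (`Cruxes/TwoProducts/Lines/coincidence_dichotomy_P2.lean`):
in one weight-order cell the number of visible points is `≤ c·(1 + √coin E)`, where `coin E` (restated VERBATIM below) counts the
additive coincidences of the tail support `E`: ordered non-trivial solutions of `a + b = a' + b'` in `E` plus incidences
`a + b = z ∈ E`.  THIS FILE PROVES IT with `c = 8` (`planarCell_two_le_sqrt_coin`: `#S ≤ 4·⌊√coin⌋ + 8`; `visibleLeSqrtCoin`: the
P2 statement token-for-token with `∃ c`).  It interpolates the two landed calibrations: `coin = 0` gives a `t`-free bound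
(cf. `planarCell_two_coincidenceFree`, p601769) and the staircase family of `Negative/PlanarSlotBoundFalse.lean` (p600147) has
`K + 1` visible points with `coin ≍ K²` — so the law is tight up to constants there.

Proof.  (i) Every visible `l ∉ E` has a representation `l = g + g'` whose MAIN TERM `⟨φ g, ψ g'⟩` is nonzero (`2·W[l]` is the
sum of the main terms over the antidiagonal, by its swap symmetry).  (ii) By the crossing lemma `nested_of_visible` (p601372) the
`g`'s of distinct points compare strictly in the cell, and for `x` outer to `y` the cross point `g_x + g'_y` outweighs `l_y`, so
`W = 0` there.  (iii) Call `{x, y}` BAD if that cross point lies in `E` or has a second representation; on a pairwise GOOD set the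
main terms form a triangular pairing (`coeff_tailDiff_add_eq_zero_iff`, p601769), so the `φ g_x ∈ ℂ⁴` are linearly independent
(`linearIndependent_of_triangular`): good sets have `≤ 4` points.  (iv) TURÁN-LITE (`sq_le_card_badPairs` of
`…PlanarCellTuranLite.lean`: peel a maximal good set — every other point has a bad partner in it): `(V − 4)² ≤ 8·#(ordered bad pairs)`.  (v) An
outer-ordered bad pair records `(g_x, g'_y)`, hence injects into one of the two sets counted by `coin`: `#bad ≤ 2·coin`.

Honest framing: an `m = 2` per-cell law (fixed `m` is trivially polynomial for the crux); it identifies additive coincidences of the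
tail support as the quantitative source of visible points at `m = 2`.  `PlanarCross`, `PlanarCellBound`, the engine, the crux
`TwoProducts` are OPEN; `VP ≠ VNP` is NOT proved.  No named facts. [folklore]
-/

noncomputable section

-- Sub = Summit single-conjunct layout: the duplicated namespace component is mandated by the tree.
set_option linter.dupNamespace false

open scoped BigOperators
open MvPolynomial
open Summit.ValiantsHypothesis.ValiantsHypothesis.Theorems.NewtonUnitEquations.TwoProducts.FormalLogLinearisation

namespace Summit.ValiantsHypothesis.ValiantsHypothesis.Theorems.NewtonUnitEquations.TwoProducts.PlanarCell

/-- Additive coincidence count of a finite planar set (VERBATIM `CoincidenceDichotomy.coin` of val-idea-8's P2 file): ordered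
solutions of `a + b = a' + b'` with `{a,b} ≠ {a',b'}` plus incidences `a + b = z` with `a, b, z ∈ E`. [folklore] -/
noncomputable def coin (E : Finset Expo) : ℕ :=
  (((E ×ˢ E) ×ˢ (E ×ˢ E)).filter (fun q => q.1.1 + q.1.2 = q.2.1 + q.2.2 ∧ q.1 ≠ q.2 ∧ q.1 ≠ (q.2.2, q.2.1))).card +
  (((E ×ˢ E) ×ˢ E).filter (fun q => q.1.1 + q.1.2 = q.2)).card

/-! ## The main terms of a visible point outside the tail support -/

variable (u v : Fin 2 → MvPolynomial (Fin 2) ℂ)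

/-- A nonzero main-term pairing `⟨φ a, ψ b⟩ ≠ 0` forces `a, b` into the tail support. [folklore] -/
theorem mem_tailSupport_of_pairing_ne_zero {a b : Expo} (h : phiVec u v a ⬝ᵥ psiVec u v b ≠ 0) :
    a ∈ tailSupport u v ∧ b ∈ tailSupport u v := by
  have hT : ∀ (w : Fin 2 → MvPolynomial (Fin 2) ℂ) (j : Fin 2) (e : Expo), (w = u ∨ w = v) →
      coeff e (w j) ≠ 0 → e ∈ tailSupport u v := by
    rintro w j e (rfl | rfl) he
    · exact Finset.mem_union_left _ (Finset.mem_biUnion.2 ⟨j, Finset.mem_univ _, mem_support_iff.2 he⟩)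
    · exact Finset.mem_union_right _ (Finset.mem_biUnion.2 ⟨j, Finset.mem_univ _, mem_support_iff.2 he⟩)
  rw [phiVec_dotProduct_psiVec] at h
  by_contra hnot
  rw [not_and_or] at hnot
  apply h
  rcases hnot with ha | hb
  · have h0 : coeff a (u 0) = 0 := by by_contra hc; exact ha (hT u 0 a (Or.inl rfl) hc)
    have h1 : coeff a (u 1) = 0 := by by_contra hc; exact ha (hT u 1 a (Or.inl rfl) hc)
    have h2 : coeff a (v 0) = 0 := by by_contra hc; exact ha (hT v 0 a (Or.inr rfl) hc)
    have h3 : coeff a (v 1) = 0 := by by_contra hc; exact ha (hT v 1 a (Or.inr rfl) hc)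
    rw [h0, h1, h2, h3]; ring
  · have h0 : coeff b (u 0) = 0 := by by_contra hc; exact hb (hT u 0 b (Or.inl rfl) hc)
    have h1 : coeff b (u 1) = 0 := by by_contra hc; exact hb (hT u 1 b (Or.inl rfl) hc)
    have h2 : coeff b (v 0) = 0 := by by_contra hc; exact hb (hT v 0 b (Or.inr rfl) hc)
    have h3 : coeff b (v 1) = 0 := by by_contra hc; exact hb (hT v 1 b (Or.inr rfl) hc)
    rw [h0, h1, h2, h3]; ring

/-- Twice the coefficient of `W` at a point OUTSIDE the tail support is the sum of the main-term pairings over the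
antidiagonal (swap symmetry). [folklore] -/
theorem two_mul_coeff_tailDiff_eq_sum (l : Expo) (hl : l ∉ tailSupport u v) :
    2 * coeff l (tailDiff u v) = ∑ x ∈ Finset.HasAntidiagonal.antidiagonal l, phiVec u v x.1 ⬝ᵥ psiVec u v x.2 := by
  classical
  have hT : ∀ (w : Fin 2 → MvPolynomial (Fin 2) ℂ) (j : Fin 2), (w = u ∨ w = v) → coeff l (w j) = 0 := by
    rintro w j (rfl | rfl) <;> by_contra hc <;> apply hl
    · exact Finset.mem_union_left _ (Finset.mem_biUnion.2 ⟨j, Finset.mem_univ _, mem_support_iff.2 hc⟩)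
    · exact Finset.mem_union_right _ (Finset.mem_biUnion.2 ⟨j, Finset.mem_univ _, mem_support_iff.2 hc⟩)
  have hexp : tailDiff u v = (u 0 + u 1 + u 0 * u 1) - (v 0 + v 1 + v 0 * v 1) := by
    unfold tailDiff; simp only [Fin.prod_univ_two]; ring
  set q : Expo × Expo → ℂ := fun x => coeff x.1 (u 0) * coeff x.2 (u 1) - coeff x.1 (v 0) * coeff x.2 (v 1) with hq
  have hcoeff : coeff l (tailDiff u v) = ∑ x ∈ Finset.HasAntidiagonal.antidiagonal l, q x := by
    rw [hexp, coeff_sub, coeff_add, coeff_add, coeff_add, coeff_add, hT u 0 (Or.inl rfl), hT u 1 (Or.inl rfl),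
      hT v 0 (Or.inr rfl), hT v 1 (Or.inr rfl), coeff_mul, coeff_mul]
    simp only [zero_add, hq, ← Finset.sum_sub_distrib]
  have hswap : ∑ x ∈ Finset.HasAntidiagonal.antidiagonal l, q x =
      ∑ x ∈ Finset.HasAntidiagonal.antidiagonal l, q x.swap := by
    refine Finset.sum_equiv (Equiv.prodComm Expo Expo) (fun x => ?_) (fun x _ => ?_)
    · rw [Equiv.prodComm_apply, Finset.HasAntidiagonal.swap_mem_antidiagonal]
    · simp
  have h1 := hcoeff
  have h2 := hcoeff.trans hswap
  calc 2 * coeff l (tailDiff u v) = coeff l (tailDiff u v) + coeff l (tailDiff u v) := two_mul _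
    _ = (∑ x ∈ Finset.HasAntidiagonal.antidiagonal l, q x) +
          ∑ x ∈ Finset.HasAntidiagonal.antidiagonal l, q x.swap := by rw [← h2, ← h1]
    _ = ∑ x ∈ Finset.HasAntidiagonal.antidiagonal l, (q x + q x.swap) := (Finset.sum_add_distrib).symm
    _ = ∑ x ∈ Finset.HasAntidiagonal.antidiagonal l, phiVec u v x.1 ⬝ᵥ psiVec u v x.2 := by
          refine Finset.sum_congr rfl fun x _ => ?_
          rw [phiVec_dotProduct_psiVec]
          simp only [hq, Prod.fst_swap, Prod.snd_swap]

/-- **A visible point outside the tail support has a representation with nonzero main term.** [folklore] -/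
theorem exists_rep_pairing_ne_zero (l : Expo) (hl : l ∉ tailSupport u v) (hW : coeff l (tailDiff u v) ≠ 0) :
    ∃ g ∈ tailSupport u v, ∃ g' ∈ tailSupport u v, g + g' = l ∧ phiVec u v g ⬝ᵥ psiVec u v g' ≠ 0 := by
  classical
  have h2 : ∑ x ∈ Finset.HasAntidiagonal.antidiagonal l, phiVec u v x.1 ⬝ᵥ psiVec u v x.2 ≠ 0 := by
    rw [← two_mul_coeff_tailDiff_eq_sum u v l hl]
    exact mul_ne_zero two_ne_zero hW
  obtain ⟨x, hx, hne⟩ := Finset.exists_ne_zero_of_sum_ne_zero h2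
  obtain ⟨ha, hb⟩ := mem_tailSupport_of_pairing_ne_zero u v hne
  exact ⟨x.1, ha, x.2, hb, Finset.HasAntidiagonal.mem_antidiagonal.1 hx, hne⟩

/-! ## The √coin law -/

/-- **`m = 2`: #visible per cell ≤ 4·⌊√coin E⌋ + 8.** [folklore] -/
theorem planarCell_two_le_sqrt_coin (hu : ∀ j, coeff 0 (u j) = 0) (hv : ∀ j, coeff 0 (v j) = 0)
    (R : Expo → Expo → Prop) (S : Finset Expo)
    (hS : ∀ l ∈ S, ∃ ξ : Fin 2 → ℝ, ValidWeight u v ξ ∧ IsStrictTop ξ (logSupport u v) l ∧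
      ∀ e ∈ tailSupport u v, ∀ e' ∈ tailSupport u v, (R e e' ↔ wt ξ e ≤ wt ξ e')) :
    S.card ≤ 4 * Nat.sqrt (coin (tailSupport u v)) + 8 := by
  classical
  set T := tailSupport u v with hT
  rcases S.eq_empty_or_nonempty with hS0 | ⟨l₀, hl₀⟩
  · simp [hS0]
  obtain ⟨ζ, -, -, hRζ⟩ := hS l₀ hl₀
  choose! ξ hval htop hRξ using hS
  have htopW : ∀ l ∈ S, IsStrictTop (ξ l) ↑(tailDiff u v).support l := fun l hl =>
    (stub_logLinearisation 2 u v hu hv (ξ l) (hval l hl) l).2 (htop l hl)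
  have hsupp : ∀ l ∈ S, l ∈ (tailDiff u v).support := fun l hl => (htopW l hl).1
  set S₁ := S.filter (fun l => l ∈ T) with hS₁
  set S₂ := S.filter (fun l => l ∉ T) with hS₂
  have hS₁card : S₁.card ≤ 1 := by
    refine Finset.card_le_one.2 fun l hl l' hl' => ?_
    rw [hS₁, Finset.mem_filter] at hl hl'
    exact eq_of_visible_mem_tailSupport u v R hl.2 hl'.2 (htop l hl.1) (htop l' hl'.1) (hRξ l hl.1) (hRξ l' hl'.1)
  have hS₂S : ∀ l ∈ S₂, l ∈ S := fun l hl => by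
    rw [hS₂, Finset.mem_filter] at hl; exact hl.1
  have hS₂T : ∀ l ∈ S₂, l ∉ T := fun l hl => by
    rw [hS₂, Finset.mem_filter] at hl; exact hl.2
  -- representations with nonzero main term
  have hrep : ∀ l ∈ S₂, ∃ p : Expo × Expo, p.1 ∈ T ∧ p.2 ∈ T ∧ p.1 + p.2 = l ∧
      phiVec u v p.1 ⬝ᵥ psiVec u v p.2 ≠ 0 := by
    intro l hl
    obtain ⟨g, hg, g', hg', hsum, hne⟩ :=
      exists_rep_pairing_ne_zero u v l (hS₂T l hl) (mem_support_iff.1 (hsupp l (hS₂S l hl)))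
    exact ⟨(g, g'), hg, hg', hsum, hne⟩
  choose! dec hdec1 hdec2 hdecsum hdecpair using hrep
  have hnest : ∀ l ∈ S₂, ∀ l' ∈ S₂, l ≠ l' →
      (wt ζ (dec l').1 < wt ζ (dec l).1 ∧ wt ζ (dec l).2 < wt ζ (dec l').2) ∨
      (wt ζ (dec l).1 < wt ζ (dec l').1 ∧ wt ζ (dec l').2 < wt ζ (dec l).2) := fun l hl l' hl' hne =>
    nested_of_visible u v R hne (hdec1 l hl) (hdec2 l hl) (hdec1 l' hl') (hdec2 l' hl')
      (hdecsum l hl).symm (hdecsum l' hl').symm (htop l (hS₂S l hl)) (htop l' (hS₂S l' hl')) hRζ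
      (hRξ l (hS₂S l hl)) (hRξ l' (hS₂S l' hl'))
  -- strict transfer of key comparisons to witnesses
  have tr : ∀ l ∈ S, ∀ a ∈ T, ∀ b ∈ T, wt ζ a < wt ζ b → wt (ξ l) a < wt (ξ l) b := by
    intro l hl a ha b hb hlt
    by_contra hle
    have : wt ζ b ≤ wt ζ a := (hRζ b hb a ha).1 ((hRξ l hl b hb a ha).2 (not_lt.1 hle))
    exact absurd hlt (not_lt.2 this)
  -- key, cross points, good pairs
  let key : Expo → ℝ := fun l => wt ζ (dec l).1
  have hkeyinj : ∀ l ∈ S₂, ∀ l' ∈ S₂, key l = key l' → l = l' := by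
    intro l hl l' hl' h
    by_contra hne
    rcases hnest l hl l' hl' hne with ⟨h1, -⟩ | ⟨h1, -⟩
    · simp only [key] at h; rw [h] at h1; exact lt_irrefl _ h1
    · simp only [key] at h; rw [h] at h1; exact lt_irrefl _ h1
  -- when `x` is outer to `y`, the cross point is not a support point
  have hcross0 : ∀ x ∈ S₂, ∀ y ∈ S₂, key y < key x → coeff ((dec x).1 + (dec y).2) (tailDiff u v) = 0 := by
    intro x hx y hy hlt
    set c := (dec x).1 + (dec y).2 with hc
    have hwt : wt (ξ y) y < wt (ξ y) c := by
      have h' := tr y (hS₂S y hy) _ (hdec1 y hy) _ (hdec1 x hx) hlt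
      have e : wt (ξ y) y = wt (ξ y) (dec y).1 + wt (ξ y) (dec y).2 := by
        have := congrArg (wt (ξ y)) (hdecsum y hy).symm
        rw [this, wt_add]
      rw [e, hc, wt_add]
      linarith
    by_contra hne
    have hmem : c ∈ ((tailDiff u v).support : Set Expo) := mem_support_iff.2 hne
    have hcy : c ≠ y := fun h => by rw [h] at hwt; exact lt_irrefl _ hwt
    have := (htopW y (hS₂S y hy)).2 c hmem hcy
    exact absurd hwt (not_lt.2 this.le)
  -- GOOD ordered pairs: the cross point is off `T` and uniquely represented
  let Good : Expo → Expo → Prop := fun x y =>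
    (dec x).1 + (dec y).2 ∉ T ∧ ∀ c ∈ T, ∀ d ∈ T, c + d = (dec x).1 + (dec y).2 →
      (c = (dec x).1 ∧ d = (dec y).2) ∨ (c = (dec y).2 ∧ d = (dec x).1)
  let Bad : Expo → Expo → Prop := fun x y => (key y < key x ∧ ¬ Good x y) ∨ (key x < key y ∧ ¬ Good y x)
  have hBadsymm : ∀ x y, Bad x y → Bad y x := fun x y h => h.elim Or.inr Or.inl
  -- pairwise-good sets have at most four elements
  have hgoodset : ∀ I ⊆ S₂, (∀ x ∈ I, ∀ y ∈ I, x ≠ y → ¬ Bad x y) → I.card ≤ 4 := by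
    intro I hI hIgood
    let φ : ↥I → (Fin 4 → ℂ) := fun x => phiVec u v (dec x.1).1
    let ψ : ↥I → (Fin 4 → ℂ) := fun y => psiVec u v (dec y.1).2
    let keyI : ↥I → ℝ := fun x => key x.1
    have hkI : Function.Injective keyI := fun x y h =>
      Subtype.ext (hkeyinj x.1 (hI x.2) y.1 (hI y.2) h)
    have h0 : ∀ x y : ↥I, keyI y < keyI x → φ x ⬝ᵥ ψ y = 0 := by
      intro x y hlt
      have hne : (x : Expo) ≠ y := fun h => by
        have : keyI x = keyI y := by simp only [keyI]; rw [h]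
        rw [this] at hlt; exact lt_irrefl _ hlt
      have hgood : Good x.1 y.1 := by
        have := hIgood x.1 x.2 y.1 y.2 hne
        simp only [Bad, not_or, not_and, not_not] at this
        exact this.1 hlt
      exact (coeff_tailDiff_add_eq_zero_iff u v _ _ hgood.1 hgood.2).1
        (hcross0 x.1 (hI x.2) y.1 (hI y.2) hlt)
    have h1 : ∀ x : ↥I, φ x ⬝ᵥ ψ x ≠ 0 := fun x => hdecpair x.1 (hI x.2)
    have hLI := linearIndependent_of_triangular keyI hkI φ ψ h0 h1
    have h := hLI.fintype_card_le_finrank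
    rw [Module.finrank_fin_fun, Fintype.card_coe] at h
    exact h
  -- Turán-lite
  have hturan := sq_le_card_badPairs Bad hBadsymm S₂ hgoodset
  set BP := (S₂ ×ˢ S₂).filter (fun p => p.1 ≠ p.2 ∧ Bad p.1 p.2) with hBP
  -- outer-ordered bad pairs
  set BO := (S₂ ×ˢ S₂).filter (fun p => key p.2 < key p.1 ∧ ¬ Good p.1 p.2) with hBO
  have hBP_le : BP.card ≤ BO.card + BO.card := by
    have hsub : BP ⊆ BO ∪ BO.image Prod.swap := by
      intro p hp
      rw [hBP, Finset.mem_filter, Finset.mem_product] at hp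
      obtain ⟨⟨hp1, hp2⟩, -, hbad⟩ := hp
      rcases hbad with ⟨hk, hg⟩ | ⟨hk, hg⟩
      · exact Finset.mem_union_left _ (Finset.mem_filter.2 ⟨Finset.mem_product.2 ⟨hp1, hp2⟩, hk, hg⟩)
      · refine Finset.mem_union_right _ (Finset.mem_image.2 ⟨(p.2, p.1), ?_, rfl⟩)
        exact Finset.mem_filter.2 ⟨Finset.mem_product.2 ⟨hp2, hp1⟩, hk, hg⟩
    calc BP.card ≤ (BO ∪ BO.image Prod.swap).card := Finset.card_le_card hsub
      _ ≤ BO.card + (BO.image Prod.swap).card := Finset.card_union_le _ _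
      _ ≤ BO.card + BO.card := Nat.add_le_add_left Finset.card_image_le _
  -- bad pairs inject into the two coincidence sets
  set C1 := ((T ×ˢ T) ×ˢ (T ×ˢ T)).filter
    (fun q => q.1.1 + q.1.2 = q.2.1 + q.2.2 ∧ q.1 ≠ q.2 ∧ q.1 ≠ (q.2.2, q.2.1)) with hC1
  set C2 := ((T ×ˢ T) ×ˢ T).filter (fun q => q.1.1 + q.1.2 = q.2) with hC2
  have hcoin : coin T = C1.card + C2.card := rfl
  set BO1 := BO.filter (fun p => (dec p.1).1 + (dec p.2).2 ∈ T) with hBO1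
  set BO2 := BO.filter (fun p => (dec p.1).1 + (dec p.2).2 ∉ T) with hBO2
  have hBOsplit : BO.card = BO1.card + BO2.card := by
    rw [hBO1, hBO2]; exact (Finset.card_filter_add_card_filter_not _).symm
  -- injectivity of `p ↦ ((dec p.1).1, (dec p.2).2)` on `S₂ × S₂`
  have hrecinj : ∀ p ∈ S₂ ×ˢ S₂, ∀ p' ∈ S₂ ×ˢ S₂,
      ((dec p.1).1, (dec p.2).2) = ((dec p'.1).1, (dec p'.2).2) → p = p' := by
    intro p hp p' hp' h
    obtain ⟨h1, h2⟩ := Prod.mk.inj h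
    rw [Finset.mem_product] at hp hp'
    have e1 : p.1 = p'.1 := hkeyinj _ hp.1 _ hp'.1 (by simp only [key]; rw [h1])
    have e2 : p.2 = p'.2 := by
      by_contra hne
      rcases hnest _ hp.2 _ hp'.2 hne with ⟨-, hlt⟩ | ⟨-, hlt⟩
      · rw [h2] at hlt; exact lt_irrefl _ hlt
      · rw [h2] at hlt; exact lt_irrefl _ hlt
    exact Prod.ext e1 e2
  have hBO1card : BO1.card ≤ C2.card := by
    refine Finset.card_le_card_of_injOn (fun p => (((dec p.1).1, (dec p.2).2), (dec p.1).1 + (dec p.2).2)) ?_ ?_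
    · intro p hp
      rw [Finset.mem_coe, hBO1, Finset.mem_filter, hBO, Finset.mem_filter, Finset.mem_product] at hp
      obtain ⟨⟨⟨hp1, hp2⟩, -, -⟩, hmem⟩ := hp
      exact Finset.mem_filter.2 ⟨Finset.mem_product.2 ⟨Finset.mem_product.2 ⟨hdec1 _ hp1, hdec2 _ hp2⟩, hmem⟩, rfl⟩
    · intro p hp p' hp' h
      have hpS : p ∈ S₂ ×ˢ S₂ := (Finset.mem_filter.1 (Finset.mem_filter.1 hp).1).1
      have hp'S : p' ∈ S₂ ×ˢ S₂ := (Finset.mem_filter.1 (Finset.mem_filter.1 hp').1).1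
      exact hrecinj p hpS p' hp'S (Prod.mk.inj h).1
  have hBO2card : BO2.card ≤ C1.card := by
    -- a second representation for each pair in `BO2`
    have hwit : ∀ p ∈ BO2, ∃ cd : Expo × Expo, cd.1 ∈ T ∧ cd.2 ∈ T ∧ cd.1 + cd.2 = (dec p.1).1 + (dec p.2).2 ∧
        cd ≠ ((dec p.1).1, (dec p.2).2) ∧ cd ≠ ((dec p.2).2, (dec p.1).1) := by
      intro p hp
      rw [hBO2, Finset.mem_filter, hBO, Finset.mem_filter] at hp
      obtain ⟨⟨-, -, hng⟩, hnT⟩ := hp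
      simp only [Good, not_and_or] at hng
      rcases hng with h | h
      · exact absurd hnT h
      · push Not at h
        obtain ⟨c, hc, d, hd, hsum, h1, h2⟩ := h
        refine ⟨(c, d), hc, hd, hsum, ?_, ?_⟩
        · intro heq; exact h1 (Prod.mk.inj heq).1 (Prod.mk.inj heq).2
        · intro heq; exact h2 (Prod.mk.inj heq).1 (Prod.mk.inj heq).2
    choose! wit hwit1 hwit2 hwitsum hwitne1 hwitne2 using hwit
    refine Finset.card_le_card_of_injOn (fun p => (wit p, ((dec p.1).1, (dec p.2).2))) ?_ ?_
    · intro p hp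
      rw [Finset.mem_coe] at hp
      have hpS : p ∈ S₂ ×ˢ S₂ := (Finset.mem_filter.1 (Finset.mem_filter.1 hp).1).1
      rw [Finset.mem_product] at hpS
      refine Finset.mem_filter.2 ⟨Finset.mem_product.2 ⟨Finset.mem_product.2 ⟨hwit1 p hp, hwit2 p hp⟩,
        Finset.mem_product.2 ⟨hdec1 _ hpS.1, hdec2 _ hpS.2⟩⟩, hwitsum p hp, hwitne1 p hp, ?_⟩
      exact hwitne2 p hp
    · intro p hp p' hp' h
      have hpS : p ∈ S₂ ×ˢ S₂ := (Finset.mem_filter.1 (Finset.mem_filter.1 hp).1).1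
      have hp'S : p' ∈ S₂ ×ˢ S₂ := (Finset.mem_filter.1 (Finset.mem_filter.1 hp').1).1
      exact hrecinj p hpS p' hp'S (Prod.mk.inj h).2
  -- assemble
  have hsq : (S₂.card - 4) * (S₂.card - 4) ≤ 16 * coin T := by
    rw [hcoin]
    calc (S₂.card - 4) * (S₂.card - 4) ≤ 8 * BP.card := hturan
      _ ≤ 8 * (BO.card + BO.card) := Nat.mul_le_mul_left _ hBP_le
      _ ≤ 16 * (C1.card + C2.card) := by rw [hBOsplit]; omega
  have hsqrt : S₂.card - 4 < 4 * (Nat.sqrt (coin T) + 1) := by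
    have hlt : coin T < (Nat.sqrt (coin T) + 1) * (Nat.sqrt (coin T) + 1) := by
      have := Nat.lt_succ_sqrt (coin T)
      simpa [Nat.succ_eq_add_one] using this
    have h16 : (S₂.card - 4) * (S₂.card - 4) < (4 * (Nat.sqrt (coin T) + 1)) * (4 * (Nat.sqrt (coin T) + 1)) := by
      nlinarith
    exact Nat.mul_self_lt_mul_self_iff.1 h16
  have hsplit : S.card = S₁.card + S₂.card := by
    rw [hS₁, hS₂]; exact (Finset.card_filter_add_card_filter_not _).symm
  omega

/-- **`VisibleLeSqrtCoin` (val-idea-8's typed P2, token-for-token body) holds with `c = 8`.** [folklore] -/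
theorem visibleLeSqrtCoin :
    ∃ c : ℕ, ∀ (t : ℕ), 2 ≤ t → ∀ (u v : Fin 2 → MvPolynomial (Fin 2) ℂ),
      (∀ j, coeff 0 (u j) = 0 ∧ (u j).support.card ≤ t) → (∀ j, coeff 0 (v j) = 0 ∧ (v j).support.card ≤ t) →
      ∀ (R : Expo → Expo → Prop) (S : Finset Expo),
        (∀ l ∈ S, ∃ ξ : Fin 2 → ℝ, ValidWeight u v ξ ∧ IsStrictTop ξ (logSupport u v) l ∧
          ∀ e ∈ tailSupport u v, ∀ e' ∈ tailSupport u v, (R e e' ↔ wt ξ e ≤ wt ξ e')) →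
        S.card ≤ c * (1 + Nat.sqrt (coin (tailSupport u v))) := by
  refine ⟨8, fun t _ u v hu hv R S hS => ?_⟩
  have h := planarCell_two_le_sqrt_coin u v (fun j => (hu j).1) (fun j => (hv j).1) R S hS
  linarith

end Summit.ValiantsHypothesis.ValiantsHypothesis.Theorems.NewtonUnitEquations.TwoProducts.PlanarCell

end
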